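import Summits.BirchSwinnertonDyer.Rank1Residual.GaloisImage.VisibleWitnessHybridPlaces
import Summits.BirchSwinnertonDyer.Rank1Residual.GaloisImage.NonsplitMultiplicativeUnramifiedSelmer
import Literature.NumberTheory.EllipticCurves.CongruentNumberCurveSupersingular
import Literature.NumberTheory.EllipticCurves.TorsionFrobeniusProofs
import HarnessLib

/-!
# `ι_v(θ) = 1` at a NON-SPLIT multiplicative place of `E` where the partner is GOOD, from
# decidable numerals — the last open case of the hybrid witness census (r1's PAID places,
# p04's kind (iv′)) (team n1011, row T-DIV3L, FILE D10)

HONEST FRAMING (cell `b2b-bsdres`, run/shared/lean/b2b/bsd-rank1-residual/, verbatim in every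
file): the goal of the cell is to DELETE the COMBINATION-SHAPED residual classes of the
Birch–Swinnerton-Dyer formula for ALL analytic-rank `≤ 1` elliptic curves over `ℚ` — "full BSD
formula for every rank `≤ 1` curve in class `C`" assembled STRICTLY from published theorems — so
that the rank-`≤ 1` remainder becomes exactly the CONSTRUCTION-SHAPED classes, which are TYPED
(missing-input `Prop`s), NOT attempted. This is not "finishing BSD". Team n1011 (N10/N11): research
route; this file is a TOOL (assembly of tree theorems with kernel numerals); nothing is booked by
it; no mark / label moved; X4 stays CONSTRUCTION-SHAPED. THEOREMS only; no definition, no named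
fact of ours (the twisted Tate uniformisation `hU2` = registered A41′ is DISPLAYED), no `sorry`.

## What

FILE D9 (`VisibleWitnessHybridPlaces`) feeds the `hrel` binders of D5's hybrid END at r1's kinds
(ii)/(iii). The hybrid census (`HOME/b2b-bsdres-n1011-p17/gen9/census/div3_hybrid_places.json`)
left 52 places open, ALL of one shape: the target `E` NON-SPLIT multiplicative at `q`, the partner
`E′` GOOD at `q`, `q ≠ 3`. That is n1011-p04's kind (iv′) (T-NSK FILE 2, tree
`NonsplitKummer.relIndex_map_selmerLocalKer_eq_one_of_nonsplit_of_hasGoodReductionAt`: at a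
non-split multiplicative place the unramified classes lie in `E`'s Kummer image, and `E′` good at
`v ∤ 3` has exactly the unramified classes as its local condition). This file feeds that theorem
from `decide`-able data: `q ∣ Δ(E₀)`, `q ∤ c₄(E₀)` (multiplicative, tree
`hasMultiplicativeReductionAt_of_dvd_of_not_dvd`), the NON-SPLIT flag
`sqFlagAt q (N·D) w = false` for `γ(E) = −c₄/c₆ = N/D` (T-LOC3L FILE L6
`not_isSquare_algebraMap_adicCompletion_of_sqFlagAt`), `q ∤ Δ(F₀)` (partner good, tree
`hasGoodReductionAt_map_of_not_dvd`), `q ≠ 3`.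

ENDs: `relIndex_eq_one_of_nonsplit_of_good_of_sqFlagAt` (core, reduction facts displayed),
`relIndex_eq_one_of_kindIV_checks_of_intModel` (integer-model currency), kernel instance
`relIndex_eq_one_140238ck1_23373e1_at2`. With D9 + D10 every one of the 333 hybrid FAIL@3 witness
pairs has all its non-certificate places of kinds (ii)/(iii)/(iv′) (census: 320 + 115 + 52
places), i.e. kernel `hrel` inputs modulo A41/A41′.

References: [SilvermanATAEC1994] V.5.2–5.4; [MilneADT2006] I.3.8; [SilvermanAEC2009] VII.5.1(b);
[CremonaMazur2000] §3.
-/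

set_option autoImplicit false

noncomputable section

open scoped Classical

open WeierstrassCurve NumberField IsDedekindDomain Rat.HeightOneSpectrum Field
  Literature.NumberTheory.EllipticCurves Literature.NumberTheory.GaloisRepresentations
open Summit.BirchSwinnertonDyer.Rank1Residual.GaloisImage.LocalTorsion3At
  (sqFlagAt not_isSquare_algebraMap_adicCompletion_of_sqFlagAt)

namespace Summit.BirchSwinnertonDyer.Rank1Residual.GaloisImage.DivisionDecider

section KindIV

variable (q : ℕ) [hq : Fact q.Prime]

omit hq in
/-- `v ∤ 3` in the currency `(3 : 𝓞 ℚ) ∉ v.asIdeal` from `primesEquiv v = q ≠ 3`. [folklore] -/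
theorem three_not_mem_asIdeal_of_ne {v : HeightOneSpectrum (𝓞 ℚ)} (hv : (primesEquiv v : ℕ) = q)
    (hq3 : q ≠ 3) : ((3 : ℕ) : 𝓞 ℚ) ∉ v.asIdeal := fun h =>
  hq3 (hv.symm.trans (primesEquiv_eq_of_natCast_mem Nat.prime_three h))

/-- **Kind (iv′), core: `ι_v(θ) = 1` at a place `v ∤ 3` where `E` is multiplicative and NON-SPLIT
by the decidable flag (`γ(E) = −c₄/c₆ = N/D`, `sqFlagAt q (N·D) w = false`) and `E′` is GOOD** —
n1011-p04's `NonsplitKummer.relIndex_map_selmerLocalKer_eq_one_of_nonsplit_of_hasGoodReductionAt`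
fed by T-LOC3L FILE L6; conditional on the twisted Tate uniformisation `hU2` (displayed).
[cite: SilvermanATAEC1994, Ch. V Lemma 5.2 (c), Thm. 5.3, Cor. 5.4] [cite: MilneADT2006, Ch. I Prop. 3.8] -/
theorem relIndex_eq_one_of_nonsplit_of_good_of_sqFlagAt
    (hU2 : Silverman1994_thmV53_corV54_tateUniformisation.{0})
    (W W' : WeierstrassCurve ℚ) [W.IsElliptic] [W'.IsElliptic]
    (θ : geomTorsion W' ((3 : ℕ) : ℤ) ≃+ geomTorsion W ((3 : ℕ) : ℤ))
    (hθ : ∀ (σ : Field.absoluteGaloisGroup ℚ) (P : geomTorsion W' ((3 : ℕ) : ℤ)),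
      θ (σ • P) = σ • θ P)
    (hq3 : q ≠ 3) {v : HeightOneSpectrum (𝓞 ℚ)} (hv : (primesEquiv v : ℕ) = q)
    (hW : W.HasMultiplicativeReductionAt v) (hW' : W'.HasGoodReductionAt v)
    {N D : ℤ} (hD : D ≠ 0) (hγ : -(W.c₄ / W.c₆) = (N : ℚ) / (D : ℚ))
    {w : ℕ} (hw : (q : ℤ) ^ w ∣ N * D) (hw' : ¬ (q : ℤ) ^ (w + 1) ∣ N * D)
    (hflag : sqFlagAt q (N * D) w = false) :
    haveI : Fact (Nat.Prime 3) := ⟨Nat.prime_three⟩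
    (selmerLocalKer W (v.adicCompletion ℚ) ((3 : ℕ) : ℤ)).relIndex
        ((selmerLocalKer W' (v.adicCompletion ℚ) ((3 : ℕ) : ℤ)).map
          (h1Equiv θ hθ).toAddMonoidHom) = 1 := by
  haveI : Fact (Nat.Prime 3) := ⟨Nat.prime_three⟩
  exact NonsplitKummer.relIndex_map_selmerLocalKer_eq_one_of_nonsplit_of_hasGoodReductionAt W v hU2
    (by norm_num) W' θ hθ hW
    (not_isSquare_algebraMap_adicCompletion_of_sqFlagAt v hv hD hγ hw hw' hflag) hW'
    (three_not_mem_asIdeal_of_ne q hv hq3)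

/-- **Kind (iv′) from the integer models (`hrel` for the hybrid witness END at a PAID place)**: `W`
globally minimal with integer model `E₀` (`q ∣ Δ(E₀)`, `q ∤ c₄(E₀)` — multiplicative; non-split flag
on `γ = −c₄(E₀)/c₆(E₀) = N/D`), the partner `W′ = F₀ ⊗ ℚ` with `q ∤ Δ(F₀)` (good), `q ≠ 3`; every
numeral `decide`-able on literals. [cite: SilvermanAEC2009, VII.5 Prop. 5.1(b)]
[cite: SilvermanATAEC1994, Ch. V Lemma 5.2 (c), Thm. 5.3, Cor. 5.4] [cite: MilneADT2006, Ch. I Prop. 3.8] -/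
theorem relIndex_eq_one_of_kindIV_checks_of_intModel
    (hU2 : Silverman1994_thmV53_corV54_tateUniformisation.{0})
    (W W' : WeierstrassCurve ℚ) [W.IsElliptic] [W'.IsElliptic] [W.IsGloballyMinimal]
    {E₀ F₀ : WeierstrassCurve ℤ} (hI : W.integralModelInt = E₀)
    (hF : F₀.map (Int.castRingHom ℚ) = W')
    (θ : geomTorsion W' ((3 : ℕ) : ℤ) ≃+ geomTorsion W ((3 : ℕ) : ℤ))
    (hθ : ∀ (σ : Field.absoluteGaloisGroup ℚ) (P : geomTorsion W' ((3 : ℕ) : ℤ)),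
      θ (σ • P) = σ • θ P)
    (hq3 : q ≠ 3) {v : HeightOneSpectrum (𝓞 ℚ)} (hv : (primesEquiv v : ℕ) = q)
    (hΔ : (q : ℤ) ∣ E₀.Δ) (hc₄ : ¬ (q : ℤ) ∣ E₀.c₄)
    {N D : ℤ} (hD : D ≠ 0) (hγ : -((E₀.c₄ : ℚ) / (E₀.c₆ : ℚ)) = (N : ℚ) / (D : ℚ))
    {w : ℕ} (hw : (q : ℤ) ^ w ∣ N * D) (hw' : ¬ (q : ℤ) ^ (w + 1) ∣ N * D)
    (hflag : sqFlagAt q (N * D) w = false) (hΔ' : ¬ (q : ℤ) ∣ F₀.Δ) :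
    haveI : Fact (Nat.Prime 3) := ⟨Nat.prime_three⟩
    (selmerLocalKer W (v.adicCompletion ℚ) ((3 : ℕ) : ℤ)).relIndex
        ((selmerLocalKer W' (v.adicCompletion ℚ) ((3 : ℕ) : ℤ)).map
          (h1Equiv θ hθ).toAddMonoidHom) = 1 := by
  have hqv : ((primesEquiv v : ℕ) : ℤ) = (q : ℤ) := by rw [hv]
  have hWm : W.HasMultiplicativeReductionAt v :=
    W.hasMultiplicativeReductionAt_of_dvd_of_not_dvd v
      (by rw [minimalDiscriminantInt, hI, hqv]; exact hΔ) (by rw [hI, hqv]; exact hc₄)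
  have hW'g : W'.HasGoodReductionAt v := by
    rw [← hF]; exact hasGoodReductionAt_map_of_not_dvd F₀ v (by rw [hqv]; exact hΔ')
  obtain ⟨h4, h6⟩ := c₄_eq_intModel W
  rw [hI] at h4 h6
  have hγ' : -(W.c₄ / W.c₆) = (N : ℚ) / (D : ℚ) := by rw [h4, h6]; exact hγ
  exact relIndex_eq_one_of_nonsplit_of_good_of_sqFlagAt q hU2 W W' θ hθ hq3 hv hWm hW'g hD hγ' hw
    hw' hflag

end KindIV

section Instances

/-- **Instance, kind (iv′): `140238ck1 ~ 23373e1` at `q = 2`** (r1 FAIL@3 witness pair; `E` non-split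
multiplicative at `2`, `E′` good at `2` — a PAID place of r1's census): `ι_v(θ) = 1` at the place of
`2` from `E₀ = [1,−1,0,21159,−1710675]` (`2 ∣ Δ`, `2 ∤ c₄`, `γ = 47/68187`, `sqFlagAt 2 (47·68187) 0 =
false`) and `F₀ = [0,0,1,−588,26325]` (`2 ∤ Δ`); numerals by `decide +kernel`; `hU2`, `θ`, minimality,
`hF` displayed. [folklore] -/
theorem relIndex_eq_one_140238ck1_23373e1_at2
    (hU2 : Silverman1994_thmV53_corV54_tateUniformisation.{0})
    (W W' : WeierstrassCurve ℚ) [W.IsElliptic] [W'.IsElliptic] [W.IsGloballyMinimal]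
    (hI : W.integralModelInt = ⟨1, -1, 0, 21159, -1710675⟩)
    (hF : (⟨0, 0, 1, -588, 26325⟩ : WeierstrassCurve ℤ).map (Int.castRingHom ℚ) = W')
    (θ : geomTorsion W' ((3 : ℕ) : ℤ) ≃+ geomTorsion W ((3 : ℕ) : ℤ))
    (hθ : ∀ (σ : Field.absoluteGaloisGroup ℚ) (P : geomTorsion W' ((3 : ℕ) : ℤ)),
      θ (σ • P) = σ • θ P)
    {v : HeightOneSpectrum (𝓞 ℚ)} (hv : (primesEquiv v : ℕ) = 2) :
    haveI : Fact (Nat.Prime 3) := ⟨Nat.prime_three⟩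
    (selmerLocalKer W (v.adicCompletion ℚ) ((3 : ℕ) : ℤ)).relIndex
        ((selmerLocalKer W' (v.adicCompletion ℚ) ((3 : ℕ) : ℤ)).map
          (h1Equiv θ hθ).toAddMonoidHom) = 1 :=
  relIndex_eq_one_of_kindIV_checks_of_intModel 2 (hq := ⟨Nat.prime_two⟩) hU2 W W' hI hF θ hθ
    (by decide) hv (by decide +kernel) (by decide +kernel) (N := 47) (D := 68187) (by decide)
    (by decide +kernel) (w := 0) (by decide +kernel) (by decide +kernel) (by decide +kernel)
    (by decide +kernel)

end Instances

end Summit.BirchSwinnertonDyer.Rank1Residual.GaloisImage.DivisionDecider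

end
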